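import Literature.AlgebraicGeometry.AbelianSchemes.PolarizationKernelSubsetKTheta
import HarnessLib

/-!
# A homomorphism `λ : A → Â` with an AMPLE witness `λ̄_s = Λ(𝒪(Θ))` is an isogeny at `s`, hence onto on geometric points —
# the `hsurj` binder of the (V)-upgrade for a BARE hom (no `Polarization`, no type `δ`)

Layer `Literature/AlgebraicGeometry/AbelianSchemes`, namespace `Literature.AlgebraicGeometry.AbelianSchemes.AbelianSchemeOver`.
THEOREMS ONLY (no definition, no named fact, no instance, no `sorry`).  Twin of ★ `PolarizationKernelSubsetKTheta` §2–§3 /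
★ `PolarizationOntoGeometricPoints` §1–§2 with the POLARISATION replaced by ANY homomorphism `lam : A.X ⟶ D.hat.X` carrying an ample
witness at the geometric point `s` ([MumfordFogartyKirwan1994] Def. 6.3 asks exactly this at every geometric point):

* `IsLambdaOfAt.setOf_map_fibreHom_eq_one_subset_KTheta` — `ker λ̄_s (Ω) ⊆ K(Θ)` ([MumfordAV1970] §8: `ker Λ(L) = K(L)` on points; ★
  `IsLambdaOfAt.weilDiv_linEquiv_zero_of_valueAt_eq_valueAt_one` through the partner dictionary ★ `algPointsMap_fibreHom_eq_iff`);
* `IsLambdaOfAt.finite_setOf_map_fibreHom_eq_one` — hence finite for `Θ` ample ([MumfordAV1970] §6 Application 1, ★ `finite_KTheta`);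
* **`IsLambdaOfAt.isIsogeny_fibreHom_of_isAmple_of_dim_eq`** — `λ̄_s` is an ISOGENY when `dim Â_s = dim A_s` (★
  `topologicalKrullDim_ker_le_zero_of_finite`, ★ `isFinite_kerToSpec_of_topologicalKrullDim_le_zero`, ★ `IsIsogeny.of_isFinite_kerToSpec`;
  [GortzWedhorn2023] Prop. 27.176 / Cor. 27.177);
* **`IsLambdaOfAt.exists_comp_eq_of_isAmple_of_dim_eq`** — and ONTO on `Ω`-points in the `FibrePoints` currency
  (`∀ y : Â.FibrePoints s, ∃ x : A.FibrePoints s, x ≫ lam = y` — the `hsurj` binder of ★ `exists_isAmple_isLambdaOfAt_of_pow_six_of_sq`,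
  ★ `isAmple_of_linEquiv_smul_add`, ★ `exists_linEquiv_weilDiv_of_onto` VERBATIM), ★ `AlgPoints.map_surjective_of_surjective_of_isAlgClosed`.

Purpose (cell `hodgecm-mathlib`, D-0151; F-6 (V)→(VI) junction, (c1)/(O-b′) `PolarizationOfLDeltaCubeLocus` (author B-p03 (g18),
second hand B-p12 (g16); B-plan1 (g16) 08:38:32Z): the `hsurj` step «`λ̄_s` onto from an ample witness + equal dimension».
Count-neutral; HC_CM is proved only modulo the 7 printed citations until rung 0 closes.

## References
* [MumfordAV1970] D. Mumford, *Abelian Varieties* (1970), §6 Application 1 (p. 60), §8 Thm. 1 (p. 77).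
* [MumfordFogartyKirwan1994] D. Mumford, J. Fogarty, F. Kirwan, *GIT*, 3rd ed. (1994), Ch. 6 §2 Def. 6.3 (p. 120).
* [GortzWedhorn2023] U. Görtz, T. Wedhorn, *Algebraic Geometry II* (2023), Prop. 27.176 and Cor. 27.177.
-/

noncomputable section

universe u

open CategoryTheory CategoryTheory.Limits AlgebraicGeometry

namespace Literature.AlgebraicGeometry.AbelianSchemes

namespace AbelianSchemeOver

open Literature.AlgebraicGeometry.Motives
open scoped MonObj

variable {S : Scheme.{u}} (A : AbelianSchemeOver S) (D : A.DualPair) {Ω : Type u} [Field Ω] [IsAlgClosed Ω]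
  (s : Spec (.of Ω) ⟶ S) {lam : A.X ⟶ D.hat.X} [IsMonHom lam]
  {Θ : CartierDivisor (A.fibre s).toAbelianVariety.X.left}

omit [IsAlgClosed Ω] in
/-- **`ker λ̄_s (Ω) ⊆ K(Θ)`** for every witness `λ̄_s = Λ(𝒪(Θ))` of a bare homomorphism `λ : A → Â` at the geometric point `s`
([MumfordAV1970] §8: `ker Λ(L) = K(L)` on points). [cite: MumfordAV1970, §8 Thm. 1 (p. 77)] [cite: MumfordFogartyKirwan1994, Ch. 6 §2 Definition 6.3 (p. 120)] -/
theorem IsLambdaOfAt.setOf_map_fibreHom_eq_one_subset_KTheta (hΘ : A.IsLambdaOfAt s D lam Θ) :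
    {R : (A.fibre s).toAbelianVariety.Points Ω | AlgPoints.map (fibreHom lam s).hom.hom.hom R = 1} ⊆
      ((A.fibre s).toAbelianVariety.KTheta Θ : Set ((A.fibre s).toAbelianVariety.Points Ω)) := by
  intro R hR
  have h1 : AlgPoints.map (fibreHom lam s).hom.hom.hom R =
      AlgPoints.map (fibreHom lam s).hom.hom.hom (1 : (A.fibre s).toAbelianVariety.Points Ω) := by
    rw [Set.mem_setOf_eq] at hR
    rw [hR]
    have h := map_one (IsMonHom.monoidHom (fibreHom lam s).hom.hom.hom (specOver Ω Ω))
    simpa only [IsMonHom.monoidHom_apply, AlgPoints.map_apply] using h.symm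
  have hval : A.valueAt s D lam R = A.valueAt s D lam 1 := (algPointsMap_fibreHom_eq_iff A s D lam lam R 1).1 h1
  exact ((A.fibre s).toAbelianVariety.mem_KTheta_iff Θ R).2 (hΘ.weilDiv_linEquiv_zero_of_valueAt_eq_valueAt_one hval)

/-- **The kernel of `λ̄_s` on `Ω`-points is FINITE** when `λ̄_s = Λ(𝒪(Θ))` with `Θ` AMPLE (`⊆ K(Θ)`, ★ `finite_KTheta`).
[cite: MumfordAV1970, §6 Application 1 (p. 60)] -/
theorem IsLambdaOfAt.finite_setOf_map_fibreHom_eq_one (hΘ : A.IsLambdaOfAt s D lam Θ) (hamp : Θ.IsAmple) :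
    {R : (A.fibre s).toAbelianVariety.Points Ω | AlgPoints.map (fibreHom lam s).hom.hom.hom R = 1}.Finite :=
  ((A.fibre s).toAbelianVariety.finite_KTheta hamp).subset (hΘ.setOf_map_fibreHom_eq_one_subset_KTheta A D s)

/-- **`λ̄_s` IS AN ISOGENY** when it has an ample witness at `s` and `dim Â_s = dim A_s` (finite kernel on points ⇒ zero-dimensional
kernel ⇒ finite kernel scheme ⇒ isogeny in equal dimensions). [cite: MumfordAV1970, §8 Thm. 1 (p. 77)] [cite: GortzWedhorn2023, Prop. 27.176 and Cor. 27.177] -/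
theorem IsLambdaOfAt.isIsogeny_fibreHom_of_isAmple_of_dim_eq (hΘ : A.IsLambdaOfAt s D lam Θ) (hamp : Θ.IsAmple)
    (hdim : (A.fibre s).toAbelianVariety.dim = (D.hat.fibre s).toAbelianVariety.dim) :
    AbelianVariety.IsIsogeny (fibreHom lam s) := by
  have hker := AbelianVariety.topologicalKrullDim_ker_le_zero_of_finite (fibreHom lam s)
    (by simpa only [AlgPoints.map_apply] using hΘ.finite_setOf_map_fibreHom_eq_one A D s hamp)
  haveI := AbelianVariety.isFinite_kerToSpec_of_topologicalKrullDim_le_zero (fibreHom lam s) hker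
  exact AbelianVariety.IsIsogeny.of_isFinite_kerToSpec (fibreHom lam s) hdim

/-- **`λ̄_s` IS ONTO ON `Ω`-POINTS** (`FibrePoints` currency: every `y : Â.FibrePoints s` is `x ≫ λ`) when `λ̄` has an AMPLE witness at `s`
and `dim Â_s = dim A_s` — the `hsurj` binder of ★ `exists_isAmple_isLambdaOfAt_of_pow_six_of_sq` / ★ `isAmple_of_linEquiv_smul_add` /
★ `exists_linEquiv_weilDiv_of_onto` for a BARE homomorphism (the isogeny `λ̄_s` is surjective, hence onto on `Ω`-points, ★
`AlgPoints.map_surjective_of_surjective_of_isAlgClosed`; partners ★ `FibreHomPointsOfFibrePoints`).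
[cite: MumfordAV1970, §8 Thm. 1 (p. 77)] [cite: MumfordFogartyKirwan1994, Ch. 6 §2 Definition 6.3 (p. 120)] -/
theorem IsLambdaOfAt.exists_comp_eq_of_isAmple_of_dim_eq (hΘ : A.IsLambdaOfAt s D lam Θ) (hamp : Θ.IsAmple)
    (hdim : (A.fibre s).toAbelianVariety.dim = (D.hat.fibre s).toAbelianVariety.dim) (y : D.hat.FibrePoints s) :
    ∃ x : A.FibrePoints s, x ≫ lam = y := by
  have hiso := hΘ.isIsogeny_fibreHom_of_isAmple_of_dim_eq A D s hamp hdim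
  haveI : Surjective (fibreHom lam s).hom.hom.hom.left := hiso.1
  obtain ⟨Q, hQ⟩ := D.hat.exists_points_fibrePointToLeft_eq s y
  obtain ⟨P, hP⟩ := AlgPoints.map_surjective_of_surjective_of_isAlgClosed (L := Ω) (fibreHom lam s).hom.hom.hom Q
  obtain ⟨x, hx⟩ := A.exists_fibrePoints_fibrePointToLeft_eq s P
  refine ⟨x, fibrePoints_eq_of_fibrePointToLeft_eq (D.hat) s (P := Q) ?_ hQ⟩
  rw [← hP]
  exact fibrePointToLeft_map_fibreHom_eq_comp_left s lam hx

end AbelianSchemeOver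

end Literature.AlgebraicGeometry.AbelianSchemes

end
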